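import Summits.QuantumFields.YangMills.Theorems.BalabanUVNodesN21TwoRunDeviceOfBgCloseness

/-!
# N21 (NE7c) · A2 ∕ A6 SANITY for the consumer's junction (files 1–3 of this seat): the displayed hypotheses are JOINTLY INHABITED (identical runs, `ι = id`, `Δ = 0`;
# zero closeness letter), and the conclusions then say something true and non-vacuous (the gapped weight lies below the (3.2) weight; explicit dials exist)

Track A of `YM-PLAN.md` (cell `pub-ymgap`), node **N21** (NE7c, NOT PRINTED); WIDTH SEAT `pub-ymgap-dag-n21-w2` (gen 3), file 4.  THEOREMS ONLY: 0 `def`, 0 `sorry`; COUNT-NEUTRAL;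
`--kind proof --supports stmt-QuantumFields-27366 --as helper` (K3⁸ `SpineGivenEndpointR13SepCoPHV`, dag-lead KEY MAP v2 2026-08-28 10:04Z; files 1–2 of this seat were keyed K3⁷ 20544 before the re-key and stay valid under the MIS-KEY rule).  Imports this seat's file 3 `…N21TwoRunDeviceOfBgCloseness` (→ files 1, 2; dag-n21-d U1∕U2∕U5; def-T FILE 19).

WHAT IS PROVED ([bookkeeping]; vacuity guards only — NO estimate).
* §1 `bgDominated_refl` — the plaquette-wise domination hypothesis of file 3 holds between a run and ITSELF with `Δ = 0` (witness `q := q′`); hence `device_self` (`χf_θ(c)(V) ≤ χf_{θ+0}(c)(V)`)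
  and ★ `aGapAt_le_aWeightAt_of_self` — file 3's ★★★ junction at `ι = id`, `V′ = V`, `Δ = 0` reads «`aGapAt θlo θhi ≤` the common-refinement core of `a|_θ` with itself `= a|_θ`» for
  `θlo ≤ θ ≤ θhi`, i.e. dag-n21-d's `aGapAt_le_aWeightAt` is RECOVERED through the junction (the core of a term with itself is the term: `chiFactorAt_mul_self`).
* §2 `dials_of_zero_closeness` — the dials exist for the zero closeness letter (file 2's `exists_dials_of_geometric` at `C = 0`); `widthDepthLetters_of_zero_closeness` — the letter form.
* §3 `sum_shellPiece_self_eq_zero` — design (i)'s shell pieces of a `{0,1}` family against ITSELF vanish (common refinement of a term with itself is the term).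

HONEST FRAMING.  Sanity instances at degenerate data (one run compared with itself); they show the hypotheses of files 1–3 are not jointly contradictory and what the conclusions
degenerate to — nothing more; nothing of Bałaban's asserted; NE7c NOT PRINTED ∕ NOT proved; **N21 NOT discharged**; K3⁷ ∕ K3⁸ NOT claimed; counts UNMOVED (typed 28∕28 · discharged 5∕27);
never a count claim.  One finite four-torus programme at fixed `ε` — NOT ℝ⁴, NOT OS, NOT a mass gap, NOT the Clay problem.  No decl below carries a cite tag.
-/

open Finset

namespace Summit.QuantumFields.YangMills.Theorems.N21GappedCollarDesignISanity

open Literature.MathematicalPhysics.QuantumFieldTheory.Balaban1983to89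
open Literature.MathematicalPhysics.QuantumFieldTheory.Balaban1983to89.T4Continuum
open Literature.MathematicalPhysics.QuantumFieldTheory.Balaban1983to89.Node00
open Literature.MathematicalPhysics.QuantumFieldTheory.Balaban1983to89.T4IndicatorShell (shellPiece prod_eq_core_add_sum_shell)
open B14.Eq216Concrete (ukBox)
open GaugeField (plaqHol)
open GaugeGroup (dist1)
open Summit.QuantumFields.YangMills.Theorems.N21ShellSplitOfRecord13CoPH (aGapAt WidthLetter₁₃CoPH DepthLetter₁₃CoPH)
open Summit.QuantumFields.YangMills.Theorems.N21GappedCollarDesignI (aWeightAt_of_subset)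
open Summit.QuantumFields.YangMills.Theorems.N21TwoRunDevice (aGapAt_le_core_of_bgClose chiFactorAt_le_chiFactorAt_add_of_bgDominated)
open Summit.QuantumFields.YangMills.Theorems.N21GappedTopCutDials (exists_dials_of_geometric exists_widthDepthLetters_of_geometric)

/-! ## §1 One run against itself: the domination hypothesis, the device and the junction -/

section Self

variable (F : T4Family) (N : ℕ) [NeZero N] (ν : Stage7Numerics) (M : ℕ) {p : B12.RunParams} {g : ℕ → ℝ} {k : ℕ}

/-- **A2: THE DOMINATION HYPOTHESIS IS INHABITED** — a run's local backgrounds dominate themselves with `Δ = 0` (witness `q := q′`). [bookkeeping] -/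
theorem bgDominated_refl (c : Iχ F ν p g k) (V : GaugeField (F.P p.K) (k + 1) (SU N)) :
    ∀ q' ∈ plaqInside (cubeEnl (F.P p.K) (sideχ F ν p g k) c 1), ∃ q ∈ plaqInside (cubeEnl (F.P p.K) (sideχ F ν p g k) c 1),
      dist1 (plaqHol (ukBox (bgOfRecord (avOfRecord F N p.K) {U | PlaqSmall (ν.εreg * (F.P p.K).eta (k + 1) ^ 2) U}) ν.M₁
          (cubeEnl (F.P p.K) (sideχ F ν p g k) c 4) (k + 1) V) q') / (F.P p.K).eta (k + 1) ^ 2 ≤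
        dist1 (plaqHol (ukBox (bgOfRecord (avOfRecord F N p.K) {U | PlaqSmall (ν.εreg * (F.P p.K).eta (k + 1) ^ 2) U}) ν.M₁
          (cubeEnl (F.P p.K) (sideχ F ν p g k) c 4) (k + 1) V) q) / (F.P p.K).eta (k + 1) ^ 2 + 0 :=
  fun q' hq' => ⟨q', hq', by simp⟩

/-- The device degenerates to letter-monotonicity at `Δ = 0`: `χf_θ(c)(V) ≤ χf_{θ+0}(c)(V)` through file 3's device lemma. [bookkeeping] -/
theorem device_self (c : Iχ F ν p g k) (V : GaugeField (F.P p.K) (k + 1) (SU N)) (θ : ℝ) :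
    chiFactorAt F N ν p g k θ c V ≤ chiFactorAt F N ν p g k (θ + 0) c V :=
  chiFactorAt_le_chiFactorAt_add_of_bgDominated F N ν c c V V (bgDominated_refl F N ν c V)

/-- ★ **A6: THE JUNCTION AT ONE RUN AGAINST ITSELF RECOVERS dag-n21-d's `aGapAt ≤ aWeightAt`.**  With `ι = id`, `V′ = V`, `Δ = 0` the hypotheses of file 3's ★★★ junction hold (§1), the
common-refinement core of `a|_θ(P)` with itself IS `a|_θ(P)` (`chiFactorAt_mul_self`), and the conclusion reads `aGapAt θlo θhi s P V ≤ aWeightAt θ s P V` for `θlo ≤ θ ≤ θhi`. [bookkeeping] -/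
theorem aGapAt_le_aWeightAt_of_self {θlo θ θhi : ℝ} (hlo : θlo ≤ θ) (hhi : θ ≤ θhi) (s : SeqOfRecord F ν M g p.K k) {Pl : Finset (Iχ F ν p g k)}
    (hP : Pl ⊆ cubes32 F ν M p g k s) (V : GaugeField (F.P p.K) (k + 1) (SU N)) :
    aGapAt F N ν M p g k θlo θhi s Pl V ≤ aWeightAt F N ν M p g k θ s Pl V := by
  have h := aGapAt_le_core_of_bgClose F N ν M (id : Iχ F ν p g k → Iχ F ν p g k) V V le_rfl
    (fun c => bgDominated_refl F N ν c V) (fun c => bgDominated_refl F N ν c V) (by simpa using hlo) (by simpa using hhi) s hP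
  have hcore : (∏ c ∈ cubes32 F ν M p g k s \ Pl, (chiFactorAt F N ν p g k θ c V * chiFactorAt F N ν p g k θ (id c) V)) *
      ∏ c ∈ Pl, ((1 - chiFactorAt F N ν p g k θ c V) * (1 - chiFactorAt F N ν p g k θ (id c) V)) = aWeightAt F N ν M p g k θ s Pl V := by
    rw [aWeightAt_of_subset F N ν M p g k θ s hP V]
    congr 1
    · exact prod_congr rfl fun c _ => chiFactorAt_mul_self F N ν p g k θ c V
    · refine prod_congr rfl fun c _ => ?_
      have e := chiFactorAt_mul_self F N ν p g k θ c V
      simp only [id]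
      nlinarith [e]
  linarith [hcore ▸ h]

end Self

/-! ## §2 The dials at the zero closeness letter -/

section ZeroCloseness

/-- **A2: THE DIALS EXIST** at the zero closeness (file 2's geometric form with `C = 0`, `q = 0`). [bookkeeping] -/
theorem dials_of_zero_closeness :
    ∃ (ρ : ℕ → ℝ) (n : ℕ → ℕ),
      (∀ K, 0 ≤ ρ K) ∧ (∀ K, ρ K ≤ 1) ∧ Summable (fun K => 1 / ((n K : ℝ) + 1)) ∧
      (∀ K, 2 * (0 : ℝ) ≤ ρ K) ∧ (∀ K, (1 : ℝ) / 2 ≤ (1 - ρ K) ^ (n K + 2)) ∧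
      (∀ K i, i ≤ n K + 2 → (0 : ℝ) ≤ (1 - ρ K) ^ i * ρ K) :=
  exists_dials_of_geometric (δ := fun _ => 0) (C := 0) (q := 0) (fun _ => le_rfl) (fun _ => by simp) (by norm_num) le_rfl (by norm_num)

variable {N : ℕ} [NeZero N]

/-- **A2, letter form**: width ∕ depth letters exist for the zero closeness letter at every tuple. [bookkeeping] -/
theorem widthDepthLetters_of_zero_closeness :
    ∃ (ρ : WidthLetter₁₃CoPH N) (n : DepthLetter₁₃CoPH N),
      ∀ (F : T4Family) (θ : Stage13HParams F N) (hP : θ.Provisos₁₃CoPH F N) (g₀ : ℕ → ℝ) (os : List (ULoop F)),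
        (∀ K, 0 ≤ ρ F θ hP g₀ os K) ∧ (∀ K, ρ F θ hP g₀ os K ≤ 1) ∧ Summable (fun K => 1 / ((n F θ hP g₀ os K : ℝ) + 1)) ∧
        (∀ K, 2 * (fun _ _ _ _ _ _ => (0 : ℝ) : WidthLetter₁₃CoPH N) F θ hP g₀ os K ≤ ρ F θ hP g₀ os K) ∧
        (∀ K, (1 : ℝ) / 2 ≤ (1 - ρ F θ hP g₀ os K) ^ (n F θ hP g₀ os K + 2)) ∧
        (∀ K i, i ≤ n F θ hP g₀ os K + 2 → (fun _ _ _ _ _ _ => (0 : ℝ) : WidthLetter₁₃CoPH N) F θ hP g₀ os K ≤ (1 - ρ F θ hP g₀ os K) ^ i * ρ F θ hP g₀ os K) :=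
  exists_widthDepthLetters_of_geometric (fun _ _ _ _ _ _ => 0) (fun _ _ _ _ _ => 0) (fun _ _ _ _ _ => 0)
    (fun _ _ _ _ _ _ => le_rfl) (fun _ _ _ _ _ _ => by simp) (fun _ _ _ _ _ => by norm_num) (fun _ _ _ _ _ => le_rfl) (fun _ _ _ _ _ => by norm_num)

end ZeroCloseness

/-! ## §3 Design (i)'s shell pieces of a `{0,1}` family against itself vanish -/

section ShellSelf

/-- **A6 for the product lemmas**: if `pᵢ ∈ {0,1}` (idempotent) then `Σ_{i<n} shellPiece p p n i = 0` — the common refinement of a term with itself is the term, no shell. [folklore] -/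
theorem sum_shellPiece_self_eq_zero {p : ℕ → ℝ} {n : ℕ} (hp : ∀ i < n, p i * p i = p i) : ∑ i ∈ range n, shellPiece p p n i = 0 := by
  have h := prod_eq_core_add_sum_shell p p n
  have hcore : ∏ i ∈ range n, (p i * p i) = ∏ i ∈ range n, p i := prod_congr rfl fun i hi => hp i (mem_range.1 hi)
  linarith

end ShellSelf

end Summit.QuantumFields.YangMills.Theorems.N21GappedCollarDesignISanity
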